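import Summits.QuantumFields.YangMills.Theorems.BalabanUVNodesN20CoreEdgeShellDial
import Summits.QuantumFields.YangMills.Theorems.BalabanUVNodesSpineReadingOfRecord13CoPHKTower

/-!
# BalabanUVNodes ∕ N20 (NE7b) — the `hedge`-JOINT COMPANION, module 13L: THE ASCENT OF THE ℓ¹ MATCHING LETTER ALONG THE KEY DIAL IS PRICED BY THE INTRA-CLASS
# ONE-SIDED ℓ¹ DEVIATION — additively and division-free: «fine mismatch ≤ coarse mismatch + deviation of each run from the other run rescaled to the CLASS ratio»;
# at the record, module 13's pinned N21 letter (v5's identity key) FROM the same letter at ANY key reading `kr` PLUS a summable intra-`kr`-class deviation letter —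
# the return trip of the window road, with its exact bill

Cell `pub-ymgap` (HUMAN RULING D-0062 Track A; D-0149 width push), seat `pub-ymgap-dag-n20-w3` (WIDTH SEAT 3 of 3 on NODE n20 = NE7b) gen 6, CLAIM-2 ∕ INTENT-2
(pub-ymgap INBOX l.31669).  Filed `--kind proof --supports stmt-QuantumFields-20544 --as helper` (K3⁷ `SpineGivenEndpointR13SepCoPH`; skeleton v5 941dddb108cbaacf);
COUNT-NEUTRAL.
ADDITIVE — imports this lineage's module 13 `…N20CoreEdgeShellDial` (gen 5, p608626: `shellWeightBound_crOfRecord₁₃VAt_optShell_of_l1Mismatch`, `posPart_sub_exp_mul_le`) and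
dag-n20-d's `…SpineReadingOfRecord13CoPHKTower` (p610265; through it the K edition p608328: `classSetK₁₃`, `weightAK₁₃ ∕ weightBK₁₃`, `kr_mem_classSetK₁₃`, `sum_weightAK₁₃_eq ∕
sum_weightBK₁₃_eq`); node U5d's `fiberSum` ∕ `classVal` BY NAME; independent of module 13K (`…ShellDialAtKeyReading`, the DESCENT — same imports, sibling file); modifies nothing.
[III] = [Balaban1988Convergent], [LF-I∕II] = [Balaban1989LargeFieldI∕II], [King1986] = CMP 102.

WHY.  Module 13 located the two-run content of stub 2's (N19′, N21) pair under the free shell dial as ONE letter per run — the one-sided ℓ¹ mismatch at a constant,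
`Σ_T (A − e^{−c_K}B)⁺ ≤ w_K·Σ_T A` and `Σ_T (B − e^{c_K}A)⁺ ≤ w_K·Σ_T B`, `w` summable — and module 13K showed that this letter DESCENDS loss-free along every
coarsening `kr` of the key (subadditivity of `x⁺`), strictly in general.  The window road (crux card `Cruxes/SpineGivenEndpointR13SepCoPH/Ideas/window-key-core.md`;
plan g83's v6 booking `kr := wkey`) proves the letter at a COARSE key and must come back to the key the consumer reads; dag-n19-w1 prices that ASCENT for the sup-statement
`NE7.Core` by the intra-fibre OSCILLATION of the log-ratio (`…N19RekeyingAscent.core_of_core_classVal_of_fibreOsc`, `Fib`: a pairwise sup over each fibre, exponential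
currency).  THIS FILE prices the ascent of the ℓ¹ letter, where everything is ADDITIVE: for fine weights `p` (tested run) and `q ≥ 0` (reference run), a class map `π : S → T`,
a multiplier `m` and ANY class ratios `ρ : T → ℝ`,
  `Σ_S (p − m·q)⁺ ≤ Σ_T (P − m·Q)⁺ + Σ_S (p − ρ(π·)·q)⁺ + Σ_T (ρ·Q − P)⁺`   (`P ∕ Q` = the fibre sums; §1 ★★ `sum_posPart_le_coarse_add_fibreDev`),
by the pointwise split `p − m·q = (p − ρ q) + (ρ − m)·q`, `(x + y)⁺ ≤ x⁺ + y⁺`, and `Σ_fibre (ρ_τ − m)⁺ q = (ρ_τ Q_τ − m Q_τ)⁺ ≤ (P_τ − m Q_τ)⁺ + (ρ_τ Q_τ − P_τ)⁺`; at the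
class ratios `ρ_τ := P_τ ∕ Q_τ` the slack term VANISHES for non-negative weights (★★★ `sum_posPart_le_coarse_add_fibreDev_ratio`):
  «FINE MISMATCH ≤ COARSE MISMATCH + Σ_S (p − (P_{π s}∕Q_{π s})·q)⁺»,
the last sum being the one-sided ℓ¹ DEVIATION of the tested run from the reference run RESCALED TO ITS CLASS's RATIO — half the intra-class ℓ¹ distance `Σ_τ ‖p − ρ_τ q‖₁`
(the fibre sums of `p − ρ_τ q` vanish), zero iff the two runs are proportional inside every class.  With module 13K's descent this BRACKETS the located content exactly:
  `coarse ≤ fine ≤ coarse + deviation`   (both runs; same multiplier throughout; no logarithm, no positivity beyond `0 ≤` weights, no constant to name).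
AT THE RECORD (§2, dag-n20-d's K edition BY NAME): for every key reading `kr`, every tuple, `K`, `t`, multiplier `m` — ★★★ `mismatchA_record_le_keyReading_add_fibreDev` ∕
`mismatchB_…`: module 13's mismatch of `(weightA₁₃, weightB₁₃)` over `classSet₁₃` ≤ the same mismatch of `(weightAK₁₃ kr, weightBK₁₃ kr)` over `classSetK₁₃ kr` + the deviation of
`weightA₁₃` from `(weightAK₁₃∕weightBK₁₃)(kr x)·weightB₁₃` (resp. B from A); ★★ `mismatchA_record_of_keyReading_of_fibreDev` (letters: fraction `w K` at the key reading + `v K` of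
deviation ⇒ fraction `w K + v K` at the pin, `sum_weightAK₁₃_eq`); ★★★ `shellWeightBound_crOfRecord₁₃VAt_optShell_of_keyReading_of_fibreDev` — N21 AT v5's PINNED READING
`crOfRecord₁₃VAt K₀ jcut sh⋆` (module 13's optimal split of the FINE weights) FROM the two letters at ANY key reading PLUS the two summable deviation letters (module 13's
`shellWeightBound_crOfRecord₁₃VAt_optShell_of_l1Mismatch` BY NAME); N19′ there is outright (module 13 `core_crOfRecord₁₃VAt_optShell`), N20 free at `jcut = 0`.
LOCATED (for plan g84 ∕ idea-3 ∕ the n19 lanes; said, not decided): in the ℓ¹ currency the window road's whole bill for stub 2's (N19′, N21) pair at v5's pin is TWO summable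
letters per run — (W) the one-sided ℓ¹ class-mismatch modulo constants AT THE WINDOW KEY (what (YG) + the window budget are meant to supply) and (Dev) the one-sided ℓ¹ deviation,
inside each window class, of one run from the other rescaled to the class ratio (the additive shadow of dag-n19-w1's decoupling letter (D) ∕ `Fib`: «old structure is forgotten
up to a class-wise constant factor», measured in MASS not in sup) — and nothing else: `pin ≤ (W) + (Dev)` here, `(W) ≤ pin` in module 13K.  (Dev) is where first-level
saturation ∕ the extensive old-large-field contrast of the card's (N) would have to show up as NON-summable mass if (LS) holds at the record; the kernel does not decide it.
At the COLLAPSE (every class of a step read to one key) the coarse letter is the one-sided matching of the TOTALS modulo constants (node U5's target currency) and (Dev) at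
`m`-free ratio `Z_B∕Z_A` is `Z_B·Σ_x (μ_B(x) − μ_A(x))⁺` = total variation of the two CLASS LAWS times the total — so 13K∕13L at the collapse are the two directions of
dag-n20-w4's `…N20HybridClassLawCharacterisation.exists_hybridNE7_iff_target_and_classLawTV` (p609004) read in the optimal-shell currency (said for orientation; not re-typed).

HONEST FRAMING.  [folklore] finite-sum ∕ `max` arithmetic over node U5d's `fiberSum` ∕ `classVal` and the tree's SHAPE `ShellWeightBound`, dag-n20-d's K edition and this
lineage's p608626 BY NAME; count-neutral; proves NO estimate of the programme: every letter below is a HYPOTHESIS, inhabited for no Bałaban family today (A2 declared) — (W) and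
(Dev) are two-run UV-stability statements at keyed classes, NOT PRINTED for `d = 4`, NOT proved; the hypothesis-free inequalities book NOTHING about Bałaban's objects beyond
`0 ≤` class weights.  Nothing of Bałaban's asserted; no `Provisos₁₃CoPH` inhabitant claimed (K0⁷ OPEN); NE7 ∕ NE7b ∕ NE7c NOT PRINTED ∕ NOT PROVED; N19 ∕ N20 ∕ N21 NOT
discharged; K3⁷ NOT closed, not claimed, v5 STANDS; counts unmoved (typed 28∕28 · discharged 5∕28); no count claim.  One finite `𝕋⁴_{L^K}` programme at fixed `ε = L^{−K}`,
Bałaban AS PRINTED; the YM mass gap (Clay) is NOT proved by any of this — R4 closes the conditional finite-𝕋⁴ rung `BalabanLadder.UV` only; NOT ℝ⁴, NOT continuum, NOT OS.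
No `def`, no `instance`, no `notation`, no `sorry`, no private decls.  Sources (location only): [King1986] (3.10)–(3.13) pp.656–657; [LF-I] p.193; [LF-II] (1.80) p.384;
[III] (2.18) p.257, p.244 l.20–29 («restrictions only in several previous steps»).
-/

noncomputable section

open Finset
open scoped BigOperators

namespace Summit.QuantumFields.YangMills.BalabanUVNodes.N20CoreEdgeShellDialAscent

open Literature.MathematicalPhysics.QuantumFieldTheory.Balaban1983to89
open Literature.MathematicalPhysics.QuantumFieldTheory.Balaban1983to89.T4Continuum
open Literature.MathematicalPhysics.QuantumFieldTheory.Balaban1983to89.Node00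
open T4IndicatorShell (ShellWeightBound)
open T4MatchingAssembly (classVal sum_classVal classVal_nonneg)
open T4HybridMatching (fiberSum sum_fiberSum fiberSum_nonneg)
open Summit.QuantumFields.BalabanUV.T4Continuum.Spine YMDAG.UVSplit
open Summit.QuantumFields.YangMills.BalabanUVNodes.N21KeyedShellWeightShellZero (weightA₁₃_nonneg weightB₁₃_nonneg)
open Summit.QuantumFields.YangMills.BalabanUVNodes.N20CoreEdgeShellDial

/-! ## §1 Abstract: the ascent inequality (node U5d's `fiberSum` ∕ `classVal`) -/

/-- `(x + y)⁺ ≤ x⁺ + y⁺` — the positive part is subadditive. [folklore] -/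
theorem posPart_add_le (x y : ℝ) : max 0 (x + y) ≤ max 0 x + max 0 y :=
  max_le (add_nonneg (le_max_left _ _) (le_max_left _ _)) (add_le_add (le_max_right _ _) (le_max_right _ _))

/-- The RATIO SLACK at a class: for `A ≥ 0`, `(ρ − m)⁺·A ≤ (B − m·A)⁺ + (ρ·A − B)⁺` (`(ρ − m)A = (B − mA) + (ρA − B)`). [folklore] -/
theorem posPart_sub_mul_le_add (ρ m A B : ℝ) (hA : 0 ≤ A) : max 0 (ρ - m) * A ≤ max 0 (B - m * A) + max 0 (ρ * A - B) := by
  rw [max_mul_of_nonneg _ _ hA, zero_mul, show (ρ - m) * A = (B - m * A) + (ρ * A - B) by ring]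
  exact posPart_add_le _ _

/-- At the class ratio `ρ := P ∕ Q` the slack VANISHES for `P ≥ 0` (also when `Q = 0`, where Lean's `P ∕ 0 = 0` leaves `(−P)⁺ = 0`). [folklore] -/
theorem posPart_ratio_slack_eq_zero {P : ℝ} (Q : ℝ) (hP : 0 ≤ P) : max 0 (P / Q * Q - P) = 0 := by
  rcases eq_or_ne Q 0 with hQ | hQ
  · rw [hQ, mul_zero, zero_sub]
    exact max_eq_left (neg_nonpos.mpr hP)
  · rw [div_mul_cancel₀ _ hQ, sub_self, max_self]

section Fibre

variable {σ ι : Type*} [DecidableEq ι]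

/-- **ON ONE FIBRE**: split at the class's ratio — `Σ_{fibre τ} (p − m·q)⁺ ≤ Σ_{fibre τ} (p − ρ(π·)·q)⁺ + (ρ τ − m)⁺·Σ_{fibre τ} q` for `q ≥ 0` (pointwise
`p − m q = (p − ρ q) + (ρ − m) q` and `(x + y)⁺ ≤ x⁺ + y⁺`; on the fibre `ρ (π s) = ρ τ`). [folklore] -/
theorem fiberSum_posPart_le_fibreDev_add (S : Finset σ) (π : σ → ι) (p q : σ → ℝ) (m : ℝ) (ρ : ι → ℝ) (τ : ι) (hq : ∀ s ∈ S, 0 ≤ q s) :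
    fiberSum S π (fun s => max 0 (p s - m * q s)) τ ≤ fiberSum S π (fun s => max 0 (p s - ρ (π s) * q s)) τ + max 0 (ρ τ - m) * fiberSum S π q τ := by
  unfold fiberSum
  rw [Finset.mul_sum, ← Finset.sum_add_distrib]
  refine Finset.sum_le_sum fun s hs => ?_
  have hπ : π s = τ := (Finset.mem_filter.mp hs).2
  have hq' : 0 ≤ q s := hq s (Finset.mem_filter.mp hs).1
  have hsplit : p s - m * q s = (p s - ρ (π s) * q s) + (ρ τ - m) * q s := by rw [hπ]; ring
  have hmul : max 0 ((ρ τ - m) * q s) = max 0 (ρ τ - m) * q s := by rw [max_mul_of_nonneg _ _ hq', zero_mul]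
  rw [hsplit, ← hmul]
  exact posPart_add_le _ _

/-- **★★ THE ASCENT INEQUALITY** (any class ratios `ρ`): for a class map `π : S → T`, tested weights `p`, reference weights `q ≥ 0` and a multiplier `m`,
`Σ_S (p − m·q)⁺ ≤ Σ_T (fiberSum p − m·fiberSum q)⁺ + Σ_S (p − ρ(π·)·q)⁺ + Σ_T (ρ·fiberSum q − fiberSum p)⁺` — fine mismatch ≤ coarse mismatch + intra-class deviation +
ratio slack. [folklore] -/
theorem sum_posPart_le_coarse_add_fibreDev {S : Finset σ} {T : Finset ι} {π : σ → ι} (p q : σ → ℝ) (m : ℝ) (ρ : ι → ℝ)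
    (hmaps : ∀ s ∈ S, π s ∈ T) (hq : ∀ s ∈ S, 0 ≤ q s) :
    ∑ s ∈ S, max 0 (p s - m * q s) ≤
      ∑ τ ∈ T, max 0 (fiberSum S π p τ - m * fiberSum S π q τ) + ∑ s ∈ S, max 0 (p s - ρ (π s) * q s) +
        ∑ τ ∈ T, max 0 (ρ τ * fiberSum S π q τ - fiberSum S π p τ) := by
  rw [← sum_fiberSum (fun s => max 0 (p s - m * q s)) hmaps, ← sum_fiberSum (fun s => max 0 (p s - ρ (π s) * q s)) hmaps,
    ← Finset.sum_add_distrib, ← Finset.sum_add_distrib]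
  refine Finset.sum_le_sum fun τ _ => ?_
  calc fiberSum S π (fun s => max 0 (p s - m * q s)) τ
      ≤ fiberSum S π (fun s => max 0 (p s - ρ (π s) * q s)) τ + max 0 (ρ τ - m) * fiberSum S π q τ :=
        fiberSum_posPart_le_fibreDev_add S π p q m ρ τ hq
    _ ≤ fiberSum S π (fun s => max 0 (p s - ρ (π s) * q s)) τ +
          (max 0 (fiberSum S π p τ - m * fiberSum S π q τ) + max 0 (ρ τ * fiberSum S π q τ - fiberSum S π p τ)) := by
        gcongr
        exact posPart_sub_mul_le_add _ _ _ _ (fiberSum_nonneg hq τ)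
    _ = _ := by ring

/-- **★★★ THE ASCENT INEQUALITY AT THE CLASS RATIOS** `ρ_τ := fiberSum p τ ∕ fiberSum q τ` (non-negative weights; the slack vanishes):
`Σ_S (p − m·q)⁺ ≤ Σ_T (fiberSum p − m·fiberSum q)⁺ + Σ_S (p − (P_{π s}∕Q_{π s})·q)⁺` — FINE MISMATCH ≤ COARSE MISMATCH + the one-sided ℓ¹ DEVIATION of `p` from `q` rescaled to the
class ratio (half the intra-class ℓ¹ distance; zero iff the runs are proportional inside every class).  With module 13K's descent: `coarse ≤ fine ≤ coarse + deviation`. [folklore] -/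
theorem sum_posPart_le_coarse_add_fibreDev_ratio {S : Finset σ} {T : Finset ι} {π : σ → ι} (p q : σ → ℝ) (m : ℝ)
    (hmaps : ∀ s ∈ S, π s ∈ T) (hp : ∀ s ∈ S, 0 ≤ p s) (hq : ∀ s ∈ S, 0 ≤ q s) :
    ∑ s ∈ S, max 0 (p s - m * q s) ≤
      ∑ τ ∈ T, max 0 (fiberSum S π p τ - m * fiberSum S π q τ) + ∑ s ∈ S, max 0 (p s - fiberSum S π p (π s) / fiberSum S π q (π s) * q s) := by
  have h := sum_posPart_le_coarse_add_fibreDev p q m (fun τ => fiberSum S π p τ / fiberSum S π q τ) hmaps hq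
  have h0 : ∑ τ ∈ T, max 0 (fiberSum S π p τ / fiberSum S π q τ * fiberSum S π q τ - fiberSum S π p τ) = 0 :=
    Finset.sum_eq_zero fun τ _ => posPart_ratio_slack_eq_zero _ (fiberSum_nonneg hp τ)
  linarith

variable {l₀ : ℝ} {S : ℕ → Finset σ} {T : ℕ → Finset ι} {π : ℕ → σ → ι}

/-- **★★ THE LETTER ASCENDS, PRICED** (spine currency `K`, `t`; run-generic `(p, q, m)` as in module 13K): at `(K, t)`, the coarse letter `Σ_{T K} (classVal p − m·classVal q)⁺ ≤
w·Σ_{T K} classVal p` and the deviation letter `Σ_{S K} (p − (classVal p∕classVal q)(π s)·q)⁺ ≤ v·Σ_{S K} p` give the fine letter `Σ_{S K} (p − m·q)⁺ ≤ (w + v)·Σ_{S K} p`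
(totals by `sum_classVal`). [folklore] -/
theorem mismatch_le_of_mismatch_classVal_of_fibreDev (hmaps : ∀ K, ∀ s ∈ S K, π K s ∈ T K) {p q : ℕ → ℝ → σ → ℝ} {m w v : ℝ} {K : ℕ} {t : ℝ}
    (hp : ∀ s ∈ S K, 0 ≤ p K t s) (hq : ∀ s ∈ S K, 0 ≤ q K t s)
    (hcoarse : ∑ τ ∈ T K, max 0 (classVal S π p K t τ - m * classVal S π q K t τ) ≤ w * ∑ τ ∈ T K, classVal S π p K t τ)
    (hdev : ∑ s ∈ S K, max 0 (p K t s - classVal S π p K t (π K s) / classVal S π q K t (π K s) * q K t s) ≤ v * ∑ s ∈ S K, p K t s) :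
    ∑ s ∈ S K, max 0 (p K t s - m * q K t s) ≤ (w + v) * ∑ s ∈ S K, p K t s := by
  have h := sum_posPart_le_coarse_add_fibreDev_ratio (π := π K) (p K t) (q K t) m (hmaps K) hp hq
  have htot : ∑ τ ∈ T K, classVal S π p K t τ = ∑ s ∈ S K, p K t s := sum_classVal (b := p) (hmaps K) t
  rw [htot] at hcoarse
  unfold classVal at hcoarse hdev
  rw [add_mul]
  exact h.trans (add_le_add hcoarse hdev)

end Fibre

/-! ### §1b Toy: the price is paid (module 13K's two classes `s ∈ Bool` read to one class; run A `(1, 1)`, run B `(2, 0)`): coarse mismatch `0` at `c = 0`, fine run-A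
mismatch `1`, and the deviation term is exactly `1` — the ascent inequality is an EQUALITY there -/

section Toy

/-- TOY: the fine run-A mismatch at `c = 0` equals `1` and so does the deviation of run A from `(A_tot∕B_tot)·B = B` (coarse ratio `2∕2 = 1`): `Σ_s (a s − b s)⁺ =
(1 − 2)⁺ + (1 − 0)⁺ = 1`; with the coarse mismatch `(2 − 2)⁺ = 0` (module 13K's `toy_coarse_mismatch_eq_zero`) §1's bound `fine ≤ coarse + deviation` reads `1 ≤ 0 + 1`. [folklore] -/
theorem toy_fine_mismatchA_eq_deviation :
    ∑ s ∈ (Finset.univ : Finset Bool), max 0 ((fun _ : Bool => (1 : ℝ)) s - Real.exp (-0) * (fun s : Bool => if s then (0 : ℝ) else 2) s) = 1 ∧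
    ∑ s ∈ (Finset.univ : Finset Bool), max 0 ((fun _ : Bool => (1 : ℝ)) s - (2 : ℝ) / 2 * (fun s : Bool => if s then (0 : ℝ) else 2) s) = 1 := by
  refine ⟨?_, ?_⟩ <;> rw [Fintype.sum_bool] <;> norm_num

end Toy

/-! ## §2 At the record: v5's pinned carriers `(classSet₁₃, weightA₁₃, weightB₁₃)` against dag-n20-d's key-reading carriers `(classSetK₁₃ kr, weightAK₁₃ kr, weightBK₁₃ kr)` -/

section Record

variable {F : T4Family} {N : ℕ} [NeZero N] (K₀ : ℕ) (kr : KeyReading₁₃ N K₀) (θ : Stage13HParams F N) (hP : θ.Provisos₁₃CoPH F N)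
  (g₀ : ℕ → ℝ) (os : List (ULoop F))

/-- **★★★ THE ASCENT AT THE RECORD, run A** (every key reading `kr`, every tuple with core provisos, `K`, `t`, multiplier `m`): module 13's run-A mismatch of the record's
fine class weights over `classSet₁₃` is at most the same mismatch of the COARSE weights over `classSetK₁₃ kr` PLUS the one-sided ℓ¹ deviation of `weightA₁₃` from
`(weightAK₁₃∕weightBK₁₃)(kr x)·weightB₁₃` — run A against run B rescaled to the `kr`-class ratio (§1 ★★★ at n20-d's objects; `0 ≤` weights by dag-n20-w2). [bookkeeping] -/
theorem mismatchA_record_le_keyReading_add_fibreDev (m : ℝ) (K : ℕ) (t : ℝ) :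
    ∑ x ∈ classSet₁₃ θ K₀ g₀ K, max 0 (weightA₁₃ θ hP K₀ g₀ os K t x - m * weightB₁₃ θ hP K₀ g₀ os K t x) ≤
      ∑ u ∈ classSetK₁₃ θ K₀ g₀ (kr F θ hP g₀ os) K,
          max 0 (weightAK₁₃ θ hP K₀ g₀ os (kr F θ hP g₀ os) K t u - m * weightBK₁₃ θ hP K₀ g₀ os (kr F θ hP g₀ os) K t u) +
        ∑ x ∈ classSet₁₃ θ K₀ g₀ K, max 0 (weightA₁₃ θ hP K₀ g₀ os K t x -
          weightAK₁₃ θ hP K₀ g₀ os (kr F θ hP g₀ os) K t (kr F θ hP g₀ os K x) / weightBK₁₃ θ hP K₀ g₀ os (kr F θ hP g₀ os) K t (kr F θ hP g₀ os K x) *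
            weightB₁₃ θ hP K₀ g₀ os K t x) := by
  letI : ∀ Kc, DecidableEq (SiteSeqKey F Kc) := fun _ => Classical.decEq _
  exact sum_posPart_le_coarse_add_fibreDev_ratio (S := classSet₁₃ θ K₀ g₀ K) (T := classSetK₁₃ θ K₀ g₀ (kr F θ hP g₀ os) K) (π := kr F θ hP g₀ os K)
    (weightA₁₃ θ hP K₀ g₀ os K t) (weightB₁₃ θ hP K₀ g₀ os K t) m (fun x hx => kr_mem_classSetK₁₃ θ K₀ g₀ (kr F θ hP g₀ os) hx)
    (fun x _ => weightA₁₃_nonneg F θ hP K₀ g₀ os K t x) (fun x _ => weightB₁₃_nonneg F θ hP K₀ g₀ os K t x)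

/-- **★★★ THE ASCENT AT THE RECORD, run B** (B tested against `m·`A; deviation of `weightB₁₃` from `(weightBK₁₃∕weightAK₁₃)(kr x)·weightA₁₃`). [bookkeeping] -/
theorem mismatchB_record_le_keyReading_add_fibreDev (m : ℝ) (K : ℕ) (t : ℝ) :
    ∑ x ∈ classSet₁₃ θ K₀ g₀ K, max 0 (weightB₁₃ θ hP K₀ g₀ os K t x - m * weightA₁₃ θ hP K₀ g₀ os K t x) ≤
      ∑ u ∈ classSetK₁₃ θ K₀ g₀ (kr F θ hP g₀ os) K,
          max 0 (weightBK₁₃ θ hP K₀ g₀ os (kr F θ hP g₀ os) K t u - m * weightAK₁₃ θ hP K₀ g₀ os (kr F θ hP g₀ os) K t u) +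
        ∑ x ∈ classSet₁₃ θ K₀ g₀ K, max 0 (weightB₁₃ θ hP K₀ g₀ os K t x -
          weightBK₁₃ θ hP K₀ g₀ os (kr F θ hP g₀ os) K t (kr F θ hP g₀ os K x) / weightAK₁₃ θ hP K₀ g₀ os (kr F θ hP g₀ os) K t (kr F θ hP g₀ os K x) *
            weightA₁₃ θ hP K₀ g₀ os K t x) := by
  letI : ∀ Kc, DecidableEq (SiteSeqKey F Kc) := fun _ => Classical.decEq _
  exact sum_posPart_le_coarse_add_fibreDev_ratio (S := classSet₁₃ θ K₀ g₀ K) (T := classSetK₁₃ θ K₀ g₀ (kr F θ hP g₀ os) K) (π := kr F θ hP g₀ os K)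
    (weightB₁₃ θ hP K₀ g₀ os K t) (weightA₁₃ θ hP K₀ g₀ os K t) m (fun x hx => kr_mem_classSetK₁₃ θ K₀ g₀ (kr F θ hP g₀ os) hx)
    (fun x _ => weightB₁₃_nonneg F θ hP K₀ g₀ os K t x) (fun x _ => weightA₁₃_nonneg F θ hP K₀ g₀ os K t x)

/-- **★★ THE PINNED LETTER FROM THE KEY-READING LETTER AND THE DEVIATION LETTER, run A**: at `(K, t)`, fraction `w` for the run-A mismatch of the COARSE weights (module 13K
§2's hypothesis shape at `kr`) and fraction `v` for the run-A deviation ⇒ fraction `w + v` for module 13's run-A mismatch at the record (`sum_weightAK₁₃_eq`: the totals agree).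
[bookkeeping] -/
theorem mismatchA_record_of_keyReading_of_fibreDev {m w v : ℝ} {K : ℕ} {t : ℝ}
    (hcoarse : ∑ u ∈ classSetK₁₃ θ K₀ g₀ (kr F θ hP g₀ os) K,
          max 0 (weightAK₁₃ θ hP K₀ g₀ os (kr F θ hP g₀ os) K t u - m * weightBK₁₃ θ hP K₀ g₀ os (kr F θ hP g₀ os) K t u)
        ≤ w * ∑ u ∈ classSetK₁₃ θ K₀ g₀ (kr F θ hP g₀ os) K, weightAK₁₃ θ hP K₀ g₀ os (kr F θ hP g₀ os) K t u)
    (hdev : ∑ x ∈ classSet₁₃ θ K₀ g₀ K, max 0 (weightA₁₃ θ hP K₀ g₀ os K t x -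
          weightAK₁₃ θ hP K₀ g₀ os (kr F θ hP g₀ os) K t (kr F θ hP g₀ os K x) / weightBK₁₃ θ hP K₀ g₀ os (kr F θ hP g₀ os) K t (kr F θ hP g₀ os K x) *
            weightB₁₃ θ hP K₀ g₀ os K t x)
        ≤ v * ∑ x ∈ classSet₁₃ θ K₀ g₀ K, weightA₁₃ θ hP K₀ g₀ os K t x) :
    ∑ x ∈ classSet₁₃ θ K₀ g₀ K, max 0 (weightA₁₃ θ hP K₀ g₀ os K t x - m * weightB₁₃ θ hP K₀ g₀ os K t x)
      ≤ (w + v) * ∑ x ∈ classSet₁₃ θ K₀ g₀ K, weightA₁₃ θ hP K₀ g₀ os K t x := by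
  rw [sum_weightAK₁₃_eq θ hP K₀ g₀ os (kr F θ hP g₀ os) K t] at hcoarse
  rw [add_mul]
  exact (mismatchA_record_le_keyReading_add_fibreDev K₀ kr θ hP g₀ os m K t).trans (add_le_add hcoarse hdev)

/-- Run B, likewise (`sum_weightBK₁₃_eq`). [bookkeeping] -/
theorem mismatchB_record_of_keyReading_of_fibreDev {m w v : ℝ} {K : ℕ} {t : ℝ}
    (hcoarse : ∑ u ∈ classSetK₁₃ θ K₀ g₀ (kr F θ hP g₀ os) K,
          max 0 (weightBK₁₃ θ hP K₀ g₀ os (kr F θ hP g₀ os) K t u - m * weightAK₁₃ θ hP K₀ g₀ os (kr F θ hP g₀ os) K t u)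
        ≤ w * ∑ u ∈ classSetK₁₃ θ K₀ g₀ (kr F θ hP g₀ os) K, weightBK₁₃ θ hP K₀ g₀ os (kr F θ hP g₀ os) K t u)
    (hdev : ∑ x ∈ classSet₁₃ θ K₀ g₀ K, max 0 (weightB₁₃ θ hP K₀ g₀ os K t x -
          weightBK₁₃ θ hP K₀ g₀ os (kr F θ hP g₀ os) K t (kr F θ hP g₀ os K x) / weightAK₁₃ θ hP K₀ g₀ os (kr F θ hP g₀ os) K t (kr F θ hP g₀ os K x) *
            weightA₁₃ θ hP K₀ g₀ os K t x)
        ≤ v * ∑ x ∈ classSet₁₃ θ K₀ g₀ K, weightB₁₃ θ hP K₀ g₀ os K t x) :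
    ∑ x ∈ classSet₁₃ θ K₀ g₀ K, max 0 (weightB₁₃ θ hP K₀ g₀ os K t x - m * weightA₁₃ θ hP K₀ g₀ os K t x)
      ≤ (w + v) * ∑ x ∈ classSet₁₃ θ K₀ g₀ K, weightB₁₃ θ hP K₀ g₀ os K t x := by
  rw [sum_weightBK₁₃_eq θ hP K₀ g₀ os (kr F θ hP g₀ os) K t] at hcoarse
  rw [add_mul]
  exact (mismatchB_record_le_keyReading_add_fibreDev K₀ kr θ hP g₀ os m K t).trans (add_le_add hcoarse hdev)

variable (jcut : ℕ → ℕ) (sh : ShellSplit₁₃CoPH N K₀) (c : ℕ → ℝ)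

/-- **★★★ N21 AT v5's PINNED READING FROM THE LETTERS AT ANY KEY READING PLUS THE DEVIATION LETTERS** — the return trip of the window road with its exact bill: with
`sh⋆` module 13's ℓ¹-optimal split of the FINE weights at constants `c` (its `exists_optShellSplit`), summable fractions `w ≥ 0` for the two one-sided mismatches of the
`kr`-COARSE weights (at `e^{−c_K}`, `e^{c_K}`) and `v ≥ 0` for the two intra-`kr`-class deviations ⇒ `ShellWeightBound` at `crOfRecord₁₃VAt K₀ jcut sh⋆`, canonical `Wsh`
(module 13's `shellWeightBound_crOfRecord₁₃VAt_optShell_of_l1Mismatch` BY NAME at fraction `w + v`); N19′ there is outright (module 13 `core_crOfRecord₁₃VAt_optShell`), N20 free at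
`jcut = 0` (`relWeightBound_crOfRecord₁₃VAt_cutZero`).  The four letters are the two-run content — NOT PRINTED for `d = 4`, NOT proved.
[cite: Balaban1989LargeFieldII, Thm 1 + (0.1) pp.355–356, (1.80) p.384 (templates only)] [bookkeeping] -/
theorem shellWeightBound_crOfRecord₁₃VAt_optShell_of_keyReading_of_fibreDev {w v : ℕ → ℝ}
    (hsh : sh F θ hP g₀ os =
      (fun K t x => max 0 (weightA₁₃ θ hP K₀ g₀ os K t x - Real.exp (-c K) * weightB₁₃ θ hP K₀ g₀ os K t x),
       fun K t x => max 0 (weightB₁₃ θ hP K₀ g₀ os K t x - Real.exp (c K) * weightA₁₃ θ hP K₀ g₀ os K t x)))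
    (hw0 : ∀ K, 0 ≤ w K) (hws : Summable w) (hv0 : ∀ K, 0 ≤ v K) (hvs : Summable v)
    (hmA : ∀ (K : ℕ) (t : ℝ), |t| ≤ 1 →
      ∑ u ∈ classSetK₁₃ θ K₀ g₀ (kr F θ hP g₀ os) K,
          max 0 (weightAK₁₃ θ hP K₀ g₀ os (kr F θ hP g₀ os) K t u - Real.exp (-c K) * weightBK₁₃ θ hP K₀ g₀ os (kr F θ hP g₀ os) K t u)
        ≤ w K * ∑ u ∈ classSetK₁₃ θ K₀ g₀ (kr F θ hP g₀ os) K, weightAK₁₃ θ hP K₀ g₀ os (kr F θ hP g₀ os) K t u)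
    (hmB : ∀ (K : ℕ) (t : ℝ), |t| ≤ 1 →
      ∑ u ∈ classSetK₁₃ θ K₀ g₀ (kr F θ hP g₀ os) K,
          max 0 (weightBK₁₃ θ hP K₀ g₀ os (kr F θ hP g₀ os) K t u - Real.exp (c K) * weightAK₁₃ θ hP K₀ g₀ os (kr F θ hP g₀ os) K t u)
        ≤ w K * ∑ u ∈ classSetK₁₃ θ K₀ g₀ (kr F θ hP g₀ os) K, weightBK₁₃ θ hP K₀ g₀ os (kr F θ hP g₀ os) K t u)
    (hdA : ∀ (K : ℕ) (t : ℝ), |t| ≤ 1 →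
      ∑ x ∈ classSet₁₃ θ K₀ g₀ K, max 0 (weightA₁₃ θ hP K₀ g₀ os K t x -
          weightAK₁₃ θ hP K₀ g₀ os (kr F θ hP g₀ os) K t (kr F θ hP g₀ os K x) / weightBK₁₃ θ hP K₀ g₀ os (kr F θ hP g₀ os) K t (kr F θ hP g₀ os K x) *
            weightB₁₃ θ hP K₀ g₀ os K t x)
        ≤ v K * ∑ x ∈ classSet₁₃ θ K₀ g₀ K, weightA₁₃ θ hP K₀ g₀ os K t x)
    (hdB : ∀ (K : ℕ) (t : ℝ), |t| ≤ 1 →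
      ∑ x ∈ classSet₁₃ θ K₀ g₀ K, max 0 (weightB₁₃ θ hP K₀ g₀ os K t x -
          weightBK₁₃ θ hP K₀ g₀ os (kr F θ hP g₀ os) K t (kr F θ hP g₀ os K x) / weightAK₁₃ θ hP K₀ g₀ os (kr F θ hP g₀ os) K t (kr F θ hP g₀ os K x) *
            weightA₁₃ θ hP K₀ g₀ os K t x)
        ≤ v K * ∑ x ∈ classSet₁₃ θ K₀ g₀ K, weightB₁₃ θ hP K₀ g₀ os K t x) :
    ShellWeightBound (crOfRecord₁₃VAt K₀ jcut sh F θ hP g₀ os).l₀ (crOfRecord₁₃VAt K₀ jcut sh F θ hP g₀ os).T (crOfRecord₁₃VAt K₀ jcut sh F θ hP g₀ os).A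
      (crOfRecord₁₃VAt K₀ jcut sh F θ hP g₀ os).B (crOfRecord₁₃VAt K₀ jcut sh F θ hP g₀ os).shA (crOfRecord₁₃VAt K₀ jcut sh F θ hP g₀ os).shB
      (crOfRecord₁₃VAt K₀ jcut sh F θ hP g₀ os).Wsh :=
  shellWeightBound_crOfRecord₁₃VAt_optShell_of_l1Mismatch K₀ jcut sh θ hP g₀ os c hsh (fun K => add_nonneg (hw0 K) (hv0 K)) (hws.add hvs)
    (fun K t ht => mismatchA_record_of_keyReading_of_fibreDev K₀ kr θ hP g₀ os (hmA K t ht) (hdA K t ht))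
    (fun K t ht => mismatchB_record_of_keyReading_of_fibreDev K₀ kr θ hP g₀ os (hmB K t ht) (hdB K t ht))

end Record

end Summit.QuantumFields.YangMills.BalabanUVNodes.N20CoreEdgeShellDialAscent

end
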